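/-
Origin: expansion seat `prover-pub-hodgecm-mc-binder-1-g17-0`, handover #R121 2026-08-20T21:53:34Z md5 541f10f4f823 (99 l.; NEW additive MODEL leaf, ns HodgeCM.Model.LevelPullInjective; imports PKG HodgeCM.Model.TowerLevel (#R108) + PKG HodgeCM.Model.LevelTransferPush + Vendored HodgeTheory.ClassesSupportedOnComplexification; independent of #R117–#R120; drops ⇒ {#R122}; NAMES for audit: HodgeCM.Model.LevelPullInjective.trPull_one_injective_free · HodgeCM.Model.LevelPullInjective.pull_baseChange_levelCover_injective · HodgeCM.Model.LevelPullInjective.map_levelCover_injective; NAME LIST: HodgeCM.Model.LevelPullInjective.trPull_one_injective_free · HodgeCM.Model.LevelPullInjective.pull_baseChange_levelCover_injective · HodgeCM.Model.LevelPullInjective.map_levelCover_injective; all decls: HodgeCM.Model.LevelPullInjective.le_of_transCond_one · HodgeCM.Model.LevelPullInjective.map_levelCover_injective · HodgeCM.Model.LevelPullInjective.pull_baseChange_levelCover_injective · HodgeCM.Model.LevelPullInjective.trPull_one_injective_free) (`HOME/mc/pub-hodgecm-mc-binder-1-g17/stage64/HodgeCM/Model/LevelPullInjective.lean`, md5 541f10f4f823,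 99 lines);
landed by the second packager p2 gen 14 (p2-g14) in gate run 64 as `HodgeCM/Model/LevelPullInjective.lean` (verbatim).
-/
/-
Copyright (c) 2026 the pub-hodgecm formalisation cell (harness21).  New file, not vendored.
Origin: session prover-pub-hodgecm-mc-binder-1-g17-0 (unit pub-hodgecm-mc-binder-1-g17, BINDER PROVER gen 17 of lineage mc-binder-1;
content lane (J-Liu-Θ), (J3) — the (iib-T) lever «the tower without (ii-b)», root 1 of 2), 2026-08-20.
-/
import Summits.HodgeConjecture.HodgeCM.Model.TowerLevel_2
import Summits.HodgeConjecture.HodgeCM.Model.LevelTransferPush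
import Literature.AlgebraicGeometry.HodgeTheory.ClassesSupportedOnComplexification

/-!
# The transition maps of the tower are injective — WITHOUT (ii-b) `SpecialCyclesAlgebraic`

`Model/TowerInjective.lean` (#R110) proves `Injective (t_1^* : Hᵏ(X_Δ(ℂ);ℚ)_ℂ → Hᵏ(X_{Δ'}(ℂ);ℚ)_ℂ)` for `Δ' ≤ Δ` by seeing the
model's uniformisation datum as a ball-QUOTIENT datum (`modelQuotientDatum h₂`, #R90/#R101) so as to use the vendored
`UnitaryBallQuotientDatum.levelProj` covering API; that is the ONLY door through which the record
`h₂ : SpecialCyclesAlgebraic` ((ii-b), [KudlaMillson1990 Lemma 1.1] + Chow) enters the (J3) tower — and, through `res`/`resTotal`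
(#R111), the dictionary `LiuDictionary.ofTower` (#R113) and the junction `hsmall_of_tower(_at)` (#R116/#R120).

This leaf re-proves the same injectivity from the (ii-b)-FREE finite-cover theorem already in the package:
`isFiniteCover_levelCover` (`Model/LevelTransferPush.lean`, from the vendored
`UnitaryBallUniformisationDatum.isFiniteCover_of_unif_comp` — a map intertwining the uniformisations of two torsion-free ball quotients
with the same hermitian space is a finite covering, [BergeronMillsonMoeglin2016Balls Part 2 §1.3], [Borel 1969 Prop. 7.13]) and the
normalised transfer of a finite covering (vendored `IsFiniteCover.singularCohomology_map_injective`, [HatcherAT2002 §3.G Prop. 3G.1],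
coefficients in any `ℚ`-algebra), plus universal coefficients `ℂ ⊗ Hᵏ(·;ℚ) → Hᵏ(·;ℂ)` injective and natural
(`ofRatClassBaseChange_injective`, `map_ofRatClassBaseChange`):

* `pull_baseChange_levelCover_injective` — `(levelCover^*)_ℂ` is injective, for EVERY `Δ'.Γ ≤ Δ.Γ` (no normality, no core);
* `trPull_one_injective_free` — `Injective (trPull … 1 Δ' Δ ht k)` from `ht : TransCond 1 Δ' Δ` alone.

Records used: the universe's `hHD hI hU h₃` and `hA : Arapura2012_Cor_15_4_6` (behind every translate) — exactly those of the
tower carrier itself; NOT `SpecialCyclesAlgebraic`.  0 definitions, 0 records minted, nothing cited anew.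
Nothing here is a claim of the manuscripts under adjudication.
-/

noncomputable section

open scoped Matrix
open Matrix Function Set
open NumberField CategoryTheory
open Literature.AlgebraicGeometry.Motives
open Literature.AlgebraicGeometry.ShimuraVarieties
open Literature.AlgebraicGeometry.HodgeTheory
open Literature.AlgebraicTopology.SingularHomology
open Literature.NumberTheory.Automorphic
open Literature.NumberTheory.Automorphic.PicardCM
open Literature.NumberTheory.Transcendental (Arapura2012_Cor_15_4_6)

namespace HodgeCM.Model.LevelPullInjective

open HodgeCM.Model.LevelTranslate HodgeCM.Model.TowerLevel

variable (hHD : exists_isReal_hodgeModel) (hI : hodgePQ_independent_of_hodgeModel)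
  (hU : BallQuotientUniformisedDatum) (h₃ : CMAbelianVarietyRealised) (hA : Arapura2012_Cor_15_4_6)
variable {L : CMField} {ι₁ : L →+* ℂ} {V : HermSpace3 L ι₁} {Δ Δ' : Level V}

/-- `TransCond 1 Δ' Δ` is just `Δ'.Γ ≤ Δ.Γ`. -/
theorem le_of_transCond_one (ht : TransCond (1 : GL (Fin 3) L) Δ' Δ) : Δ'.Γ ≤ Δ.Γ := fun δ hδ ↦ by
  simpa using ht.apply hδ

/-- **`π(ℂ)^*` is injective on `Hᵏ(X_Δ(ℂ); ℂ)` for the level covering `π = levelCover Δ Δ'`** — any `Δ'.Γ ≤ Δ.Γ`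
(finite covering ⇒ the normalised transfer is a retraction of `π^*`). [cite: HatcherAT2002, §3.G Prop. 3G.1] -/
theorem map_levelCover_injective (hle : Δ'.Γ ≤ Δ.Γ) (k : ℕ) :
    Injective (singularCohomology.map ℂ ℂ (AlgPoints.mapContinuous (L := ℂ) (levelCover hU h₃ hHD hA Δ Δ' hle)) k) :=
  (isFiniteCover_levelCover hU h₃ hHD hA Δ Δ' hle).singularCohomology_map_injective (R := ℂ) k

/-- **`(π^*)_ℂ` is injective on `ℂ ⊗ Hᵏ(X_Δ(ℂ); ℚ)`** for `π = levelCover Δ Δ'`, any `Δ'.Γ ≤ Δ.Γ` (naturality and injectivity of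
the complexification `β`). [cite: HatcherAT2002, §3.G Prop. 3G.1] [cite: VoisinHodgeI2002, §7.1.1] -/
theorem pull_baseChange_levelCover_injective (hle : Δ'.Γ ≤ Δ.Γ) (k : ℕ) :
    Injective ((BettiUniverse.pull (levelCover hU h₃ hHD hA Δ Δ' hle) k).baseChange ℂ) := by
  have h1 := map_levelCover_injective hHD hU h₃ hA hle k
  have h2 : Injective (singularCohomology.map ℂ ℂ (AlgPoints.mapContinuous (L := ℂ) (levelCover hU h₃ hHD hA Δ Δ' hle)) k ∘
      ofRatClassBaseChange (ComplexPoints (Var.scheme hU h₃ (.pms (pmsCode L ι₁ V Δ)))) k) :=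
    h1.comp (ofRatClassBaseChange_injective _ k)
  have heq : (singularCohomology.map ℂ ℂ (AlgPoints.mapContinuous (L := ℂ) (levelCover hU h₃ hHD hA Δ Δ' hle)) k ∘
        ofRatClassBaseChange (ComplexPoints (Var.scheme hU h₃ (.pms (pmsCode L ι₁ V Δ)))) k) =
      ofRatClassBaseChange (ComplexPoints (Var.scheme hU h₃ (.pms (pmsCode L ι₁ V Δ')))) k ∘
        (BettiUniverse.pull (levelCover hU h₃ hHD hA Δ Δ' hle) k).baseChange ℂ := by
    funext t
    exact map_ofRatClassBaseChange _ k _ t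
  rw [heq] at h2
  exact Injective.of_comp h2

/-- **Injectivity of the transition maps of the tower, (ii-b)-free**: for every `Δ' ≤ Δ` (as `TransCond 1 Δ' Δ`),
`t_1^* : Hᵏ(X_Δ(ℂ); ℚ)_ℂ → Hᵏ(X_{Δ'}(ℂ); ℚ)_ℂ` is injective (`levelCover^* = t_1^*`, #R107 `pull_levelCover_eq`).
Same statement as #R110 `TowerInjective.trPull_one_injective` minus the hypothesis `SpecialCyclesAlgebraic`.
[cite: HatcherAT2002, §3.G Prop. 3G.1] -/
theorem trPull_one_injective_free (ht : TransCond ((1 : ↥(Urat V)) : GL (Fin 3) L) Δ' Δ) (k : ℕ) :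
    Injective (trPull hHD hI hU h₃ hA 1 Δ' Δ ht k) := by
  have hle : Δ'.Γ ≤ Δ.Γ := le_of_transCond_one ht
  have e : ⇑(trPull hHD hI hU h₃ hA 1 Δ' Δ ht k) =
      ⇑((BettiUniverse.pull (levelCover hU h₃ hHD hA Δ Δ' hle) k).baseChange ℂ) := by
    change ⇑((BettiUniverse.pull (transMor hU h₃ hHD hA (Subgroup.one_mem (Urat V)) Δ' Δ ht) k).baseChange ℂ) = _
    rw [pull_levelCover_eq hU h₃ hHD hA hle k]
  rw [e]
  exact pull_baseChange_levelCover_injective hHD hU h₃ hA hle k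

end HodgeCM.Model.LevelPullInjective

end
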